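import Mathlib
import Literature.LinearAlgebra.Matrix.MoorePenroseInverse
import HarnessLib

/-!
# The Moore–Penrose inverse as a limit of regularised inverses

Albert [Albert1972, Ch. III] *defines* the pseudoinverse of a real matrix `H` by the limit formula

  `H⁺ = lim_{δ → 0} (Hᵀ H + δ² I)⁻¹ Hᵀ = lim_{δ → 0} Hᵀ (H Hᵀ + δ² I)⁻¹`   [Albert1972, Thm (3.4)]

(the limit "always exists"; Albert attributes the result to den Broeder and Charnes), after the
preliminary

  **Lemma (3.3)**: for a symmetric `A`,
  `P_A = lim_{δ → 0} (A + δ I)⁻¹ A = lim_{δ → 0} A (A + δ I)⁻¹`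
  always exists and is the projection on the range of `A`.

This file proves both statements for matrices over an `RCLike` field `𝕜` (Hermitian in place of
symmetric, `ᴴ` in place of `ᵀ`). Lemma (3.3) is stated, as in Albert, for the punctured
two-sided limit `δ → 0`, `δ ≠ 0` (the filter `𝓝[≠] 0`); in Theorem (3.4) the limit is taken as
`δ → 0⁺` (the filter `𝓝[>] 0`) through the regularisation parameter itself, i.e. through Albert's
`δ² > 0`. The limit objects are identified with the Moore–Penrose inverse `pinv` of
`Literature.LinearAlgebra.Matrix.MoorePenroseInverse` (characterised there by the four Penrose
equations, [Penrose1955, Thm 1] = [Albert1972, Thm (3.9)]):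

* `inv_add_smul_one_eq` — the resolvent of a Hermitian matrix in its eigenbasis,
  `(H + δ)⁻¹ = U diag((λᵢ + δ)⁻¹) Uᴴ` whenever no `λᵢ + δ` vanishes [Albert1972, (3.6) and the
  proof of Lemma (3.3)];
* `tendsto_inv_add_smul_one_mul_self`, `tendsto_self_mul_inv_add_smul_one` — **Lemma (3.3)**:
  `(H + δ)⁻¹ H → H⁺ H` and `H (H + δ)⁻¹ → H H⁺` as `δ → 0`, `δ ≠ 0` (and `H⁺ H = H H⁺` is the
  projection on the range of `H`, [Albert1972, Cor. (3.5)]);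
* `tendsto_inv_conjTranspose_mul_self_add_smul_one_mul`,
  `tendsto_conjTranspose_mul_inv_self_mul_conjTranspose_add_smul_one` — **Theorem (3.4)**,
  eqs. (3.4.1) and (3.4.2): `(Aᴴ A + δ)⁻¹ Aᴴ → A⁺` and `Aᴴ (A Aᴴ + δ)⁻¹ → A⁺` as `δ → 0⁺`, for an
  arbitrary rectangular `A`; the two regularised expressions agree for every `δ > 0`
  (`inv_conjTranspose_mul_self_add_smul_one_mul_eq`, the first display of Albert's proof), and
  `Aᴴ A + δ` is invertible for `δ > 0`;
* `tendsto_regularizedSolution` — the vector form of (3.4.1): the regularised least-squares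
  solutions `x_δ = (Aᴴ A + δ)⁻¹ Aᴴ z` converge to the minimum-norm least-squares solution `A⁺ z`
  [Albert1972, Thm (3.4)];
* `tendsto_mul_conjTranspose_mul_inv`, `tendsto_inv_mul_conjTranspose_mul_self` — the limit
  formulas for the projections `A A⁺` and `A⁺ A` [Albert1972, Cor. (3.5), proof].

All limits are entrywise (the product topology on `Matrix`), obtained from the spectral theorem and
the scalar limit `(λ + δ)⁻¹ λ → λ⁺ λ`.
-/

open Matrix Filter
open scoped Topology ComplexOrder

namespace Literature.LinearAlgebra.Matrix.MoorePenrose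

variable {𝕜 : Type*} [RCLike 𝕜]
variable {m n : Type*} [Fintype m] [Fintype n]

/-! ### The resolvent of a Hermitian matrix in its eigenbasis -/

section Hermitian

variable [DecidableEq n] {H : Matrix n n 𝕜}

/-- Conjugation by a matrix with `Uᴴ U = 1` is multiplicative. [folklore] -/
private theorem conj_mul_conj' {U : Matrix n n 𝕜} (hU : Uᴴ * U = 1) (P Q : Matrix n n 𝕜) :
    U * P * Uᴴ * (U * Q * Uᴴ) = U * (P * Q) * Uᴴ := by
  calc U * P * Uᴴ * (U * Q * Uᴴ) = U * P * (Uᴴ * U) * Q * Uᴴ := by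
        simp only [Matrix.mul_assoc]
    _ = U * (P * Q) * Uᴴ := by rw [hU, Matrix.mul_one, Matrix.mul_assoc U P Q]

/-- `Uᴴ U = 1` for the eigenvector matrix of a Hermitian matrix. [folklore] -/
private theorem eigU_conjTranspose_mul_self (hH : H.IsHermitian) :
    (hH.eigenvectorUnitary : Matrix n n 𝕜)ᴴ * (hH.eigenvectorUnitary : Matrix n n 𝕜) = 1 := by
  rw [← star_eq_conjTranspose]
  exact Unitary.coe_star_mul_self hH.eigenvectorUnitary

/-- `U Uᴴ = 1` for the eigenvector matrix of a Hermitian matrix. [folklore] -/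
private theorem eigU_mul_conjTranspose_self (hH : H.IsHermitian) :
    (hH.eigenvectorUnitary : Matrix n n 𝕜) * (hH.eigenvectorUnitary : Matrix n n 𝕜)ᴴ = 1 := by
  rw [← star_eq_conjTranspose]
  exact Unitary.coe_mul_star_self hH.eigenvectorUnitary

/-- The spectral theorem in product form `H = U diag(λ) Uᴴ`. [folklore] -/
private theorem eq_conj_diagonal' (hH : H.IsHermitian) :
    H = (hH.eigenvectorUnitary : Matrix n n 𝕜) * diagonal (fun i => (hH.eigenvalues i : 𝕜)) *
      (hH.eigenvectorUnitary : Matrix n n 𝕜)ᴴ := by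
  have h := hH.spectral_theorem
  rw [Unitary.conjStarAlgAut_apply, star_eq_conjTranspose] at h
  exact h

/-- `H + δ = U diag(λᵢ + δ) Uᴴ` in the eigenbasis of `H`. [folklore] -/
private theorem add_smul_one_eq_conj_diagonal (hH : H.IsHermitian) (δ : ℝ) :
    H + (δ : 𝕜) • (1 : Matrix n n 𝕜) =
      (hH.eigenvectorUnitary : Matrix n n 𝕜) *
        diagonal (fun i => ((hH.eigenvalues i + δ : ℝ) : 𝕜)) *
        (hH.eigenvectorUnitary : Matrix n n 𝕜)ᴴ := by
  have hsplit : diagonal (fun i => ((hH.eigenvalues i + δ : ℝ) : 𝕜)) =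
      diagonal (fun i => (hH.eigenvalues i : 𝕜)) + (δ : 𝕜) • (1 : Matrix n n 𝕜) := by
    rw [smul_one_eq_diagonal, diagonal_add]
    congr 1
    funext i
    push_cast
    rfl
  rw [hsplit, Matrix.mul_add, Matrix.add_mul, ← eq_conj_diagonal' hH, Matrix.mul_smul,
    Matrix.mul_one, Matrix.smul_mul, eigU_mul_conjTranspose_self hH]

/-- **The resolvent in the eigenbasis.** If `H = U diag(λ) Uᴴ` is the spectral decomposition of a
Hermitian matrix and no `λᵢ + δ` vanishes, then `H + δ I` is invertible with
`(H + δ I)⁻¹ = U diag((λᵢ + δ)⁻¹) Uᴴ`.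
[cite: Albert1972, (3.6) and Lemma (3.3) (proof)] -/
theorem inv_add_smul_one_eq (hH : H.IsHermitian) {δ : ℝ} (hδ : ∀ i, hH.eigenvalues i + δ ≠ 0) :
    (H + (δ : 𝕜) • (1 : Matrix n n 𝕜))⁻¹ =
      (hH.eigenvectorUnitary : Matrix n n 𝕜) *
        diagonal (fun i => ((hH.eigenvalues i + δ : ℝ) : 𝕜)⁻¹) *
          (hH.eigenvectorUnitary : Matrix n n 𝕜)ᴴ := by
  apply Matrix.inv_eq_right_inv
  rw [add_smul_one_eq_conj_diagonal hH δ, conj_mul_conj' (eigU_conjTranspose_mul_self hH),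
    diagonal_mul_diagonal]
  have h1 : (fun i => ((hH.eigenvalues i + δ : ℝ) : 𝕜) * ((hH.eigenvalues i + δ : ℝ) : 𝕜)⁻¹) =
      fun _ => (1 : 𝕜) := by
    funext i
    exact mul_inv_cancel₀ (RCLike.ofReal_ne_zero.mpr (hδ i))
  rw [h1, diagonal_one, Matrix.mul_one, eigU_mul_conjTranspose_self hH]

/-- Under the hypothesis of `inv_add_smul_one_eq`, `H + δ I` times its inverse is the identity.
[cite: Albert1972, Lemma (3.3) (proof: `(A + δ I)⁻¹` exists)] -/
theorem add_smul_one_mul_inv (hH : H.IsHermitian) {δ : ℝ} (hδ : ∀ i, hH.eigenvalues i + δ ≠ 0) :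
    (H + (δ : 𝕜) • (1 : Matrix n n 𝕜)) * (H + (δ : 𝕜) • (1 : Matrix n n 𝕜))⁻¹ = 1 := by
  rw [inv_add_smul_one_eq hH hδ, add_smul_one_eq_conj_diagonal hH δ,
    conj_mul_conj' (eigU_conjTranspose_mul_self hH), diagonal_mul_diagonal]
  have h1 : (fun i => ((hH.eigenvalues i + δ : ℝ) : 𝕜) * ((hH.eigenvalues i + δ : ℝ) : 𝕜)⁻¹) =
      fun _ => (1 : 𝕜) := by
    funext i
    exact mul_inv_cancel₀ (RCLike.ofReal_ne_zero.mpr (hδ i))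
  rw [h1, diagonal_one, Matrix.mul_one, eigU_mul_conjTranspose_self hH]

/-- Under the hypothesis of `inv_add_smul_one_eq`, the inverse of `H + δ I` times `H + δ I` is the
identity. [cite: Albert1972, Lemma (3.3) (proof: `(A + δ I)⁻¹` exists)] -/
theorem inv_mul_add_smul_one (hH : H.IsHermitian) {δ : ℝ} (hδ : ∀ i, hH.eigenvalues i + δ ≠ 0) :
    (H + (δ : 𝕜) • (1 : Matrix n n 𝕜))⁻¹ * (H + (δ : 𝕜) • (1 : Matrix n n 𝕜)) = 1 :=
  mul_eq_one_comm.mp (add_smul_one_mul_inv hH hδ)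

/-- `(H + δ I)⁻¹ H = U diag((λᵢ + δ)⁻¹ λᵢ) Uᴴ`.
[cite: Albert1972, Lemma (3.3) (proof) with (3.6)] -/
theorem inv_add_smul_one_mul_self_eq (hH : H.IsHermitian) {δ : ℝ}
    (hδ : ∀ i, hH.eigenvalues i + δ ≠ 0) :
    (H + (δ : 𝕜) • (1 : Matrix n n 𝕜))⁻¹ * H =
      (hH.eigenvectorUnitary : Matrix n n 𝕜) *
        diagonal (fun i => ((hH.eigenvalues i + δ : ℝ) : 𝕜)⁻¹ * (hH.eigenvalues i : 𝕜)) *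
          (hH.eigenvectorUnitary : Matrix n n 𝕜)ᴴ := by
  have key := conj_mul_conj' (eigU_conjTranspose_mul_self hH)
    (diagonal fun i => ((hH.eigenvalues i + δ : ℝ) : 𝕜)⁻¹)
    (diagonal fun i => (hH.eigenvalues i : 𝕜))
  rw [diagonal_mul_diagonal, ← eq_conj_diagonal' hH] at key
  rw [inv_add_smul_one_eq hH hδ]
  exact key

/-- `H (H + δ I)⁻¹ = U diag(λᵢ (λᵢ + δ)⁻¹) Uᴴ = (H + δ I)⁻¹ H`.
[cite: Albert1972, Lemma (3.3) (the two limits coincide)] -/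
theorem self_mul_inv_add_smul_one_eq (hH : H.IsHermitian) {δ : ℝ}
    (hδ : ∀ i, hH.eigenvalues i + δ ≠ 0) :
    H * (H + (δ : 𝕜) • (1 : Matrix n n 𝕜))⁻¹ = (H + (δ : 𝕜) • (1 : Matrix n n 𝕜))⁻¹ * H := by
  have key := conj_mul_conj' (eigU_conjTranspose_mul_self hH)
    (diagonal fun i => (hH.eigenvalues i : 𝕜))
    (diagonal fun i => ((hH.eigenvalues i + δ : ℝ) : 𝕜)⁻¹)
  rw [diagonal_mul_diagonal, ← eq_conj_diagonal' hH] at key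
  have e : (fun i => (hH.eigenvalues i : 𝕜) * ((hH.eigenvalues i + δ : ℝ) : 𝕜)⁻¹) =
      fun i => ((hH.eigenvalues i + δ : ℝ) : 𝕜)⁻¹ * (hH.eigenvalues i : 𝕜) := by
    funext i
    exact mul_comm _ _
  rw [inv_add_smul_one_mul_self_eq hH hδ, inv_add_smul_one_eq hH hδ, key, e]

/-- `H⁺ H = U diag(λᵢ⁺ λᵢ) Uᴴ` (`λ⁺ = λ⁻¹` for `λ ≠ 0`, `0⁺ = 0`).
[cite: Albert1972, (3.6) and Cor. (3.5)] -/
theorem pinv_mul_self_eq_conj_diagonal (hH : H.IsHermitian) :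
    pinv H * H =
      (hH.eigenvectorUnitary : Matrix n n 𝕜) *
        diagonal (fun i => (hH.eigenvalues i : 𝕜)⁻¹ * (hH.eigenvalues i : 𝕜)) *
          (hH.eigenvectorUnitary : Matrix n n 𝕜)ᴴ := by
  have key := conj_mul_conj' (eigU_conjTranspose_mul_self hH)
    (diagonal fun i => (hH.eigenvalues i : 𝕜)⁻¹) (diagonal fun i => (hH.eigenvalues i : 𝕜))
  rw [diagonal_mul_diagonal, ← eq_conj_diagonal' hH] at key
  rw [pinv_eq_pinvOfIsHermitian hH]
  exact key

/-- As `δ → 0`, `δ ≠ 0`, eventually no `λᵢ + δ` vanishes (so `H + δ I` is eventually invertible).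
[folklore] -/
private theorem eventually_eigenvalues_add_ne_zero (hH : H.IsHermitian) :
    ∀ᶠ δ in 𝓝[≠] (0 : ℝ), ∀ i, hH.eigenvalues i + δ ≠ 0 := by
  refine eventually_all.mpr fun i => ?_
  rcases eq_or_ne (hH.eigenvalues i) 0 with hi | hi
  · filter_upwards [eventually_mem_nhdsWithin] with δ hδ
    rw [hi, zero_add]
    exact hδ
  · have hne : (0 : ℝ) ≠ -hH.eigenvalues i := by
      intro h; exact hi (by linarith)
    filter_upwards [(eventually_ne_nhds hne).filter_mono nhdsWithin_le_nhds] with δ hδ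
    intro h
    exact hδ (by linarith)

/-- The scalar limit `(r + δ)⁻¹ r → r⁺ r` as `δ → 0`, `δ ≠ 0` (`= 1` for `r ≠ 0`, `= 0` for
`r = 0`).
[folklore] -/
private theorem tendsto_inv_add_mul_self (r : ℝ) :
    Tendsto (fun δ : ℝ => ((r + δ : ℝ) : 𝕜)⁻¹ * (r : 𝕜)) (𝓝[≠] 0) (𝓝 ((r : 𝕜)⁻¹ * (r : 𝕜))) := by
  rcases eq_or_ne r 0 with hr | hr
  · subst hr
    simp only [RCLike.ofReal_zero, mul_zero]
    exact tendsto_const_nhds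
  · apply tendsto_nhdsWithin_of_tendsto_nhds
    have hc : Continuous fun δ : ℝ => ((r + δ : ℝ) : 𝕜) :=
      RCLike.continuous_ofReal.comp (continuous_const.add continuous_id)
    have h0 : Tendsto (fun δ : ℝ => ((r + δ : ℝ) : 𝕜)) (𝓝 0) (𝓝 (r : 𝕜)) := by
      simpa using hc.tendsto 0
    exact (h0.inv₀ (RCLike.ofReal_ne_zero.mpr hr)).mul tendsto_const_nhds

/-- Conjugating a convergent family of diagonal matrices by a fixed matrix preserves the limit.
[folklore] -/
private theorem tendsto_conj_diagonal (U : Matrix n n 𝕜) {d : ℝ → n → 𝕜} {d₀ : n → 𝕜}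
    {l : Filter ℝ} (hd : Tendsto d l (𝓝 d₀)) :
    Tendsto (fun δ => U * diagonal (d δ) * Uᴴ) l (𝓝 (U * diagonal d₀ * Uᴴ)) := by
  have hc : Continuous fun v : n → 𝕜 => U * diagonal v * Uᴴ :=
    (continuous_const.matrix_mul continuous_id.matrix_diagonal).matrix_mul continuous_const
  exact (hc.tendsto d₀).comp hd

/-- **Albert's Lemma (3.3)** (Hermitian version): `(H + δ I)⁻¹ H → H⁺ H` as `δ → 0` (`δ ≠ 0`, of
either sign); the limit `P_H = H⁺ H` is the orthogonal projection on the range of `H`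
([Albert1972, Lemma (3.3) and Cor. (3.5)]). [cite: Albert1972, Lemma (3.3)] -/
theorem tendsto_inv_add_smul_one_mul_self (hH : H.IsHermitian) :
    Tendsto (fun δ : ℝ => (H + (δ : 𝕜) • (1 : Matrix n n 𝕜))⁻¹ * H) (𝓝[≠] 0) (𝓝 (pinv H * H)) := by
  have hd : Tendsto
      (fun δ : ℝ => fun i => ((hH.eigenvalues i + δ : ℝ) : 𝕜)⁻¹ * (hH.eigenvalues i : 𝕜))
      (𝓝[≠] 0) (𝓝 fun i => (hH.eigenvalues i : 𝕜)⁻¹ * (hH.eigenvalues i : 𝕜)) :=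
    tendsto_pi_nhds.mpr fun i => tendsto_inv_add_mul_self (hH.eigenvalues i)
  have hlim := tendsto_conj_diagonal (hH.eigenvectorUnitary : Matrix n n 𝕜) hd
  rw [← pinv_mul_self_eq_conj_diagonal hH] at hlim
  refine hlim.congr' ?_
  filter_upwards [eventually_eigenvalues_add_ne_zero hH] with δ hδ
  exact (inv_add_smul_one_mul_self_eq hH hδ).symm

/-- **Albert's Lemma (3.3)**, second form: `H (H + δ I)⁻¹ → H H⁺ (= H⁺ H)` as `δ → 0`, `δ ≠ 0`.
[cite: Albert1972, Lemma (3.3)] -/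
theorem tendsto_self_mul_inv_add_smul_one (hH : H.IsHermitian) :
    Tendsto (fun δ : ℝ => H * (H + (δ : 𝕜) • (1 : Matrix n n 𝕜))⁻¹) (𝓝[≠] 0) (𝓝 (H * pinv H)) := by
  rw [mul_pinv_comm_of_isHermitian hH]
  refine (tendsto_inv_add_smul_one_mul_self hH).congr' ?_
  filter_upwards [eventually_eigenvalues_add_ne_zero hH] with δ hδ
  exact (self_mul_inv_add_smul_one_eq hH hδ).symm

end Hermitian

/-! ### Theorem (3.4): the regularisation limit for an arbitrary matrix -/

section General

/-- `𝓝[>] 0 ≤ 𝓝[≠] 0`: a one-sided limit at `0` follows from the punctured two-sided one.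
[folklore] -/
private theorem nhdsGT_le_nhdsNE_zero : 𝓝[>] (0 : ℝ) ≤ 𝓝[≠] 0 :=
  nhdsWithin_mono 0 fun _ hx => ne_of_gt hx

variable [DecidableEq n] (A : Matrix m n 𝕜)

/-- For `δ > 0` no eigenvalue of `Aᴴ A` is `-δ` (they are all `≥ 0`). [folklore] -/
private theorem eigenvalues_conjTranspose_mul_self_add_ne_zero {δ : ℝ} (hδ : 0 < δ) (i : n) :
    (isHermitian_conjTranspose_mul_self A).eigenvalues i + δ ≠ 0 :=
  ne_of_gt (add_pos_of_nonneg_of_pos (Matrix.eigenvalues_conjTranspose_mul_self_nonneg A i) hδ)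

/-- `Aᴴ A + δ I` is invertible for `δ > 0`: it times its inverse is the identity.
[cite: Albert1972, Thm (3.4) (proof: "`(HᵀH + δ²I)` has an inverse when `δ² > 0`, (2.13)")] -/
theorem conjTranspose_mul_self_add_smul_one_mul_inv {δ : ℝ} (hδ : 0 < δ) :
    (Aᴴ * A + (δ : 𝕜) • (1 : Matrix n n 𝕜)) * (Aᴴ * A + (δ : 𝕜) • (1 : Matrix n n 𝕜))⁻¹ = 1 :=
  add_smul_one_mul_inv (isHermitian_conjTranspose_mul_self A)
    (eigenvalues_conjTranspose_mul_self_add_ne_zero A hδ)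

/-- `Aᴴ A + δ I` is invertible for `δ > 0`: its inverse times it is the identity.
[cite: Albert1972, Thm (3.4) (proof: "`(HᵀH + δ²I)` has an inverse when `δ² > 0`, (2.13)")] -/
theorem inv_mul_conjTranspose_mul_self_add_smul_one {δ : ℝ} (hδ : 0 < δ) :
    (Aᴴ * A + (δ : 𝕜) • (1 : Matrix n n 𝕜))⁻¹ * (Aᴴ * A + (δ : 𝕜) • (1 : Matrix n n 𝕜)) = 1 :=
  inv_mul_add_smul_one (isHermitian_conjTranspose_mul_self A)
    (eigenvalues_conjTranspose_mul_self_add_ne_zero A hδ)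

/-- **Albert's Theorem (3.4), eq. (3.4.1)** (den Broeder–Charnes): `(Aᴴ A + δ I)⁻¹ Aᴴ → A⁺` as
`δ → 0⁺`, for every (rectangular) matrix `A` (Albert writes the regularisation parameter as `δ²`,
`δ → 0`). [cite: Albert1972, Thm (3.4) eq. (3.4.1)] -/
theorem tendsto_inv_conjTranspose_mul_self_add_smul_one_mul :
    Tendsto (fun δ : ℝ => (Aᴴ * A + (δ : 𝕜) • (1 : Matrix n n 𝕜))⁻¹ * Aᴴ) (𝓝[>] 0)
      (𝓝 (pinv A)) := by
  -- `Aᴴ = (Aᴴ A) A⁺`, so the family is `((AᴴA + δ)⁻¹ (AᴴA)) A⁺`, and Lemma (3.3) applies.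
  have hfun : (fun δ : ℝ => (Aᴴ * A + (δ : 𝕜) • (1 : Matrix n n 𝕜))⁻¹ * Aᴴ) =
      fun δ : ℝ => (Aᴴ * A + (δ : 𝕜) • (1 : Matrix n n 𝕜))⁻¹ * (Aᴴ * A) * pinv A := by
    funext δ
    symm
    simp only [Matrix.mul_assoc]
    rw [conjTranspose_mul_mul_pinv]
  have e := pinv_eq_pinv_conjTranspose_mul_self_mul A
  have hlim : pinv (Aᴴ * A) * (Aᴴ * A) * pinv A = pinv A := by
    calc pinv (Aᴴ * A) * (Aᴴ * A) * pinv A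
        = pinv (Aᴴ * A) * (Aᴴ * A) * pinv (Aᴴ * A) * Aᴴ := by
          rw [e]; simp only [Matrix.mul_assoc]
      _ = pinv (Aᴴ * A) * Aᴴ := by rw [pinv_mul_self_mul_pinv]
      _ = pinv A := e.symm
  have hc : Continuous fun M : Matrix n n 𝕜 => M * pinv A :=
    continuous_id.matrix_mul continuous_const
  have h := (hc.tendsto _).comp
    ((tendsto_inv_add_smul_one_mul_self (isHermitian_conjTranspose_mul_self A)).mono_left
      nhdsGT_le_nhdsNE_zero)
  rw [hlim] at h
  rw [hfun]
  exact h

/-- **Regularised least squares converge to the pseudoinverse solution**: for every `z`,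
`x_δ = (Aᴴ A + δ I)⁻¹ Aᴴ z → A⁺ z` as `δ → 0⁺`; `A⁺ z` is the vector of minimum norm among the
minimisers of `‖z - A x‖²` (`residual_sq_pinv_mulVec_le` and
`norm_sq_pinv_mulVec_le_of_normalEquations` in `MoorePenroseInverse`).
[cite: Albert1972, Thm (3.4)] -/
theorem tendsto_regularizedSolution (z : m → 𝕜) :
    Tendsto (fun δ : ℝ => ((Aᴴ * A + (δ : 𝕜) • (1 : Matrix n n 𝕜))⁻¹ * Aᴴ) *ᵥ z) (𝓝[>] 0)
      (𝓝 (pinv A *ᵥ z)) := by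
  have hc : Continuous fun M : Matrix n m 𝕜 => M *ᵥ z :=
    continuous_id.matrix_mulVec continuous_const
  exact (hc.tendsto _).comp (tendsto_inv_conjTranspose_mul_self_add_smul_one_mul A)

/-- The projection `A⁺ A` on the range of `Aᴴ` as a limit: `(Aᴴ A + δ I)⁻¹ Aᴴ A → A⁺ A`.
[cite: Albert1972, Cor. (3.5) (proof, via (3.4.1) and Lemma (3.3))] -/
theorem tendsto_inv_mul_conjTranspose_mul_self :
    Tendsto (fun δ : ℝ => (Aᴴ * A + (δ : 𝕜) • (1 : Matrix n n 𝕜))⁻¹ * (Aᴴ * A)) (𝓝[>] 0)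
      (𝓝 (pinv A * A)) := by
  rw [pinv_mul_self_eq A]
  exact (tendsto_inv_add_smul_one_mul_self (isHermitian_conjTranspose_mul_self A)).mono_left
    nhdsGT_le_nhdsNE_zero

section Both

variable [DecidableEq m]

omit [DecidableEq n] in
/-- For `δ > 0` no eigenvalue of `A Aᴴ` is `-δ`. [folklore] -/
private theorem eigenvalues_self_mul_conjTranspose_add_ne_zero {δ : ℝ} (hδ : 0 < δ) (i : m) :
    (isHermitian_mul_conjTranspose_self A).eigenvalues i + δ ≠ 0 :=
  ne_of_gt (add_pos_of_nonneg_of_pos (Matrix.eigenvalues_self_mul_conjTranspose_nonneg A i) hδ)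

omit [DecidableEq n] in
/-- `A Aᴴ + δ I` is invertible for `δ > 0`.
[cite: Albert1972, Thm (3.4) (proof: "`(HHᵀ + δ²I)` has an inverse when `δ² > 0`, (2.13)")] -/
theorem self_mul_conjTranspose_add_smul_one_mul_inv {δ : ℝ} (hδ : 0 < δ) :
    (A * Aᴴ + (δ : 𝕜) • (1 : Matrix m m 𝕜)) * (A * Aᴴ + (δ : 𝕜) • (1 : Matrix m m 𝕜))⁻¹ = 1 :=
  add_smul_one_mul_inv (isHermitian_mul_conjTranspose_self A)
    (eigenvalues_self_mul_conjTranspose_add_ne_zero A hδ)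

/-- The two regularised expressions agree: `(Aᴴ A + δ I)⁻¹ Aᴴ = Aᴴ (A Aᴴ + δ I)⁻¹` for `δ > 0`.
[cite: Albert1972, Thm (3.4) (proof, first display: the right sides of (3.4.1), (3.4.2) agree)] -/
theorem inv_conjTranspose_mul_self_add_smul_one_mul_eq {δ : ℝ} (hδ : 0 < δ) :
    (Aᴴ * A + (δ : 𝕜) • (1 : Matrix n n 𝕜))⁻¹ * Aᴴ =
      Aᴴ * (A * Aᴴ + (δ : 𝕜) • (1 : Matrix m m 𝕜))⁻¹ := by
  -- `Aᴴ (A Aᴴ + δ) = (Aᴴ A + δ) Aᴴ`; multiply by the two inverses.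
  have hcomm : Aᴴ * (A * Aᴴ + (δ : 𝕜) • (1 : Matrix m m 𝕜)) =
      (Aᴴ * A + (δ : 𝕜) • (1 : Matrix n n 𝕜)) * Aᴴ := by
    rw [Matrix.mul_add, Matrix.add_mul, Matrix.mul_smul, Matrix.smul_mul, Matrix.mul_one,
      Matrix.one_mul, Matrix.mul_assoc]
  have h1 := inv_mul_conjTranspose_mul_self_add_smul_one A hδ
  have h2 := self_mul_conjTranspose_add_smul_one_mul_inv A hδ
  calc (Aᴴ * A + (δ : 𝕜) • (1 : Matrix n n 𝕜))⁻¹ * Aᴴ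
      = (Aᴴ * A + (δ : 𝕜) • (1 : Matrix n n 𝕜))⁻¹ * Aᴴ *
          ((A * Aᴴ + (δ : 𝕜) • (1 : Matrix m m 𝕜)) *
            (A * Aᴴ + (δ : 𝕜) • (1 : Matrix m m 𝕜))⁻¹) := by
        rw [h2, Matrix.mul_one]
    _ = (Aᴴ * A + (δ : 𝕜) • (1 : Matrix n n 𝕜))⁻¹ *
          (Aᴴ * (A * Aᴴ + (δ : 𝕜) • (1 : Matrix m m 𝕜))) *
            (A * Aᴴ + (δ : 𝕜) • (1 : Matrix m m 𝕜))⁻¹ := by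
        simp only [Matrix.mul_assoc]
    _ = Aᴴ * (A * Aᴴ + (δ : 𝕜) • (1 : Matrix m m 𝕜))⁻¹ := by
        rw [hcomm, ← Matrix.mul_assoc, h1, Matrix.one_mul]

/-- **Albert's Theorem (3.4), eq. (3.4.2)**: `Aᴴ (A Aᴴ + δ I)⁻¹ → A⁺` as `δ → 0⁺` (Albert's
parameter `δ²`, `δ → 0`). [cite: Albert1972, Thm (3.4) eq. (3.4.2)] -/
theorem tendsto_conjTranspose_mul_inv_self_mul_conjTranspose_add_smul_one :
    Tendsto (fun δ : ℝ => Aᴴ * (A * Aᴴ + (δ : 𝕜) • (1 : Matrix m m 𝕜))⁻¹) (𝓝[>] 0)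
      (𝓝 (pinv A)) := by
  -- `Aᴴ = A⁺ (A Aᴴ)`, so the family is `A⁺ ((AAᴴ) (AAᴴ + δ)⁻¹)`.
  have hfun : (fun δ : ℝ => Aᴴ * (A * Aᴴ + (δ : 𝕜) • (1 : Matrix m m 𝕜))⁻¹) =
      fun δ : ℝ => pinv A * (A * Aᴴ * (A * Aᴴ + (δ : 𝕜) • (1 : Matrix m m 𝕜))⁻¹) := by
    funext δ
    symm
    calc pinv A * (A * Aᴴ * (A * Aᴴ + (δ : 𝕜) • (1 : Matrix m m 𝕜))⁻¹)
        = pinv A * A * Aᴴ * (A * Aᴴ + (δ : 𝕜) • (1 : Matrix m m 𝕜))⁻¹ := by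
          simp only [Matrix.mul_assoc]
      _ = Aᴴ * (A * Aᴴ + (δ : 𝕜) • (1 : Matrix m m 𝕜))⁻¹ := by
          rw [pinv_mul_self_mul_conjTranspose]
  have e := pinv_eq_conjTranspose_mul_pinv_mul_self A
  have hlim : pinv A * (A * Aᴴ * pinv (A * Aᴴ)) = pinv A := by
    calc pinv A * (A * Aᴴ * pinv (A * Aᴴ))
        = Aᴴ * (pinv (A * Aᴴ) * (A * Aᴴ) * pinv (A * Aᴴ)) := by
          rw [e]; simp only [Matrix.mul_assoc]
      _ = Aᴴ * pinv (A * Aᴴ) := by rw [pinv_mul_self_mul_pinv]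
      _ = pinv A := e.symm
  have hc : Continuous fun M : Matrix m m 𝕜 => pinv A * M :=
    continuous_const.matrix_mul continuous_id
  have h := (hc.tendsto _).comp
    ((tendsto_self_mul_inv_add_smul_one (isHermitian_mul_conjTranspose_self A)).mono_left
      nhdsGT_le_nhdsNE_zero)
  rw [hlim] at h
  rw [hfun]
  exact h

/-- The projection `A A⁺` on the range of `A` as a limit: `A Aᴴ (A Aᴴ + δ I)⁻¹ → A A⁺`.
[cite: Albert1972, Cor. (3.5) (proof, via (3.4.2) and Lemma (3.3))] -/
theorem tendsto_mul_conjTranspose_mul_inv :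
    Tendsto (fun δ : ℝ => A * Aᴴ * (A * Aᴴ + (δ : 𝕜) • (1 : Matrix m m 𝕜))⁻¹) (𝓝[>] 0)
      (𝓝 (A * pinv A)) := by
  rw [mul_pinv_self_eq A]
  exact (tendsto_self_mul_inv_add_smul_one (isHermitian_mul_conjTranspose_self A)).mono_left
    nhdsGT_le_nhdsNE_zero

end Both

end General

end Literature.LinearAlgebra.Matrix.MoorePenrose
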